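import Summits.PneNP.PneNP.Theorems.SymmetryBudgetNoHiddenOrderReplayRootDefs
import Summits.PneNP.PneNP.Theorems.SymmetryBudgetNoHiddenOrderReplayIterStages

/-!
# `NoHiddenOrder` (stmt-PneNP-14781), (R2c) replay circuit III: the ROOT STATE module — semantics

Route `PneNP/SymmetryBudget`; data in `SymmetryBudgetNoHiddenOrderReplayRootDefs.lean`.  For a root-state module
`RR : ReplayRoot P N T J` with window `W` (`|W|² ≤ N`, `|W| ≤ T`, `|W| + 1 ≤ J`) on the input matrix `x`:

* `sem_adjG` — the adjacency gates read `rootGraph x` (the route's `Gr`);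
* `reads₀` — the root refinement module reads the initial colouring `rootCol` (signature ranks: `VecCmp.rankIn_lt_iff/eq_iff`);
* `sem_ltW_last_iff`, `sem_eqW_last_iff` — its last wires read the order/kernel of the root colouring
  `rootRef = refineIn (rootGraph x) W rootCol` on `W`;
* `sem_memW_last_iff` — the atom module of the pointer `v` reads the root block `rootBlock v = atom … v`;
* `root_inv` — the root state of `v ∈ W` contains `v`, is equitable inside its block and switching-connected;
* `stateReads_replay_root` — **from the matrix to every replayed state**: a `ReplayIter` wired to the root state of
  `v` has, at every stage `k ≤ F`, state wires reading `BranchSum.replay (rootGraph x) S hgt v k (rootBlock v, rootRef)`.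
Sorry-free; supports stmt-PneNP-14781, does not close it.
-/

set_option linter.dupNamespace false -- `Summit.PneNP.PneNP.…` (D-0017 single-conjunct layout)

namespace Summit.PneNP.PneNP.Theorems

open Finset Literature.Computability.Complexity Literature.Computability.Complexity.SymProg
open Literature.Combinatorics.SimpleGraph (ocrIter)

namespace ReplayRoot

variable {Λ : Type*} [DecidableEq Λ] {m : ℕ} {P : SymProg (Fin m × Fin m) Λ} {N T J : ℕ}
variable (RR : ReplayRoot P N T J) (x : Fin m × Fin m → Bool)

/-- The constant `true`. [folklore] -/
theorem sem_tt : P.sem x RR.tt = true := by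
  rw [P.sem_and RR.kind_tt, RR.srcs_tt]; simp

/-- The constant `false`. [folklore] -/
theorem sem_ff : P.sem x RR.ff = false := by
  rw [← Bool.not_eq_true, P.sem_or RR.kind_ff, RR.srcs_ff]; simp

/-- **The adjacency gates read the graph of the matrix.** [folklore] -/
theorem sem_adjG (u v : Fin m) : P.sem x (RR.adjG u v) = true ↔ (rootGraph x).Adj u v := by
  rw [P.sem_or (RR.kind_adjG u v), RR.srcs_adjG, SimpleGraph.fromRel_adj]
  by_cases huv : u = v
  · subst huv; simp
  · rw [if_neg huv]
    simp only [mem_insert, mem_singleton, exists_eq_or_imp, exists_eq_left, wval_inl, ne_eq, huv,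
      not_false_eq_true, true_and]

/-- The membership wires read the window. [folklore] -/
theorem sem_mem (u : Fin m) : wval x (P.sem x) (RR.RI.mem u) = true ↔ u ∈ RR.W := by
  rw [RR.RI_mem]
  by_cases hu : u ∈ RR.W
  · rw [if_pos hu, wval_inr, sem_tt]; simp [hu]
  · rw [if_neg hu, wval_inr, sem_ff]; simp [hu]

/-- The part of the root refinement module is the window. [folklore] -/
theorem part_RI : RR.RI.part x = RR.W := by
  ext u; unfold RefineIter.part
  simp only [mem_filter, mem_univ, true_and]
  exact RR.sem_mem x u

/-- **The root refinement module reads the initial colouring** of the window. [folklore] -/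
theorem reads₀ : RefineIter.Reads₀ RR.RI x ((rootGraph x).induce ((RR.RI.part x : Finset (Fin m)) : Set (Fin m)))
    (fun a => RR.rootCol x a) where
  adj_iff a b := by rw [RR.RI_adj, wval_inr]; exact RR.sem_adjG x a b
  lt0_iff a b := by
    rw [RR.RI_lt0, wval_inr, VecCmp.sem_less]
    exact (RR.VC.rankIn_lt_iff x (S := RR.W) (RR.part_RI x ▸ a.2) (b : Fin m)).symm
  eq0_iff a b := by
    rw [RR.RI_eq0, wval_inr, VecCmp.sem_eqall]
    exact (RR.VC.rankIn_eq_iff x (S := RR.W) (RR.part_RI x ▸ a.2) (RR.part_RI x ▸ b.2)).symm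

/-- **The last refinement wires read the order of the root colouring** on the window. [folklore] -/
theorem sem_ltW_last_iff (hN : RR.W.card ≤ N) (hT : RR.W.card ≤ T) {a b : Fin m} (ha : a ∈ RR.W) (hb : b ∈ RR.W) :
    wval x (P.sem x) (RR.RI.ltW (Fin.last T) a b) = true ↔ RR.rootRef x a < RR.rootRef x b := by
  have hpart := RR.part_RI x
  have key : ∀ (W' : Finset (Fin m)), W' = RR.W → ∀ (ha' : a ∈ W') (hb' : b ∈ W'),
      (ocrIter ((rootGraph x).induce (W' : Set (Fin m))) (fun z : ↥(W' : Set (Fin m)) => RR.rootCol x z) T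
          ⟨a, mem_coe.2 ha'⟩ <
        ocrIter ((rootGraph x).induce (W' : Set (Fin m))) (fun z : ↥(W' : Set (Fin m)) => RR.rootCol x z) T
          ⟨b, mem_coe.2 hb'⟩ ↔
      RR.rootRef x a < RR.rootRef x b) := by
    rintro W' rfl ha' hb'
    exact ReplayIter.ocrIter_T_lt_iff_refineIn _ (by omega) ha' hb'
  rw [← key (RR.RI.part x) hpart (hpart ▸ ha) (hpart ▸ hb)]
  exact RefineIter.sem_ltW_iff (RR.reads₀ x) (by rw [hpart]; exact hN) (Fin.last T) ⟨a, hpart ▸ ha⟩ ⟨b, hpart ▸ hb⟩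

/-- **The last refinement wires read the kernel of the root colouring** on the window. [folklore] -/
theorem sem_eqW_last_iff (hN : RR.W.card ≤ N) (hT : RR.W.card ≤ T) {a b : Fin m} (ha : a ∈ RR.W) (hb : b ∈ RR.W) :
    wval x (P.sem x) (RR.RI.eqW (Fin.last T) a b) = true ↔ RR.rootRef x a = RR.rootRef x b := by
  have hpart := RR.part_RI x
  have key : ∀ (W' : Finset (Fin m)), W' = RR.W → ∀ (ha' : a ∈ W') (hb' : b ∈ W'),
      (ocrIter ((rootGraph x).induce (W' : Set (Fin m))) (fun z : ↥(W' : Set (Fin m)) => RR.rootCol x z) T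
          ⟨a, mem_coe.2 ha'⟩ =
        ocrIter ((rootGraph x).induce (W' : Set (Fin m))) (fun z : ↥(W' : Set (Fin m)) => RR.rootCol x z) T
          ⟨b, mem_coe.2 hb'⟩ ↔
      RR.rootRef x a = RR.rootRef x b) := by
    rintro W' rfl ha' hb'
    exact ReplayIter.ocrIter_T_eq_iff_refineIn _ (by omega) ha' hb'
  rw [← key (RR.RI.part x) hpart (hpart ▸ ha) (hpart ▸ hb)]
  exact RefineIter.sem_eqW_iff (RR.reads₀ x) (by rw [hpart]; exact hN) (Fin.last T) ⟨a, hpart ▸ ha⟩ ⟨b, hpart ▸ hb⟩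

/-- **The atom module of the pointer `v` reads the root block** `atom … v`. [folklore] -/
theorem sem_memW_last_iff (hN : RR.W.card ^ 2 ≤ N) (hT : RR.W.card ≤ T) (hJ : RR.W.card + 1 ≤ J) (v u : Fin m) :
    wval x (P.sem x) ((RR.AI v).memW (Fin.last J) u) = true ↔ u ∈ RR.rootBlock x v := by
  unfold rootBlock
  have hN1 : RR.W.card ≤ N := le_trans (Nat.le_self_pow two_ne_zero _) hN
  have h := AtomIter.memW_last_iff_atom (AI := RR.AI v) (G := rootGraph x) (col := RR.rootRef x) (A := RR.W)
    (fun a b => by rw [RR.AI_adj, wval_inr]; exact RR.sem_adjG x a b)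
    (fun a ha b hb => by rw [RR.AI_eq]; exact RR.sem_eqW_last_iff x hN1 hT ha hb)
    (fun w => by rw [RR.AI_mem0]; exact RR.sem_mem x w) hN hT hJ u
  rw [RR.AI_ptr v] at h
  exact h

/-- The root block lies in the window. [folklore] -/
theorem rootBlock_subset (v : Fin m) : RR.rootBlock x v ⊆ RR.W := BranchSum.atom_subset _ _ _

/-- **The root state is a legitimate start**: the pointer lies in its block, and the block is equitable inside
and switching-connected under the root colouring. [folklore] -/
theorem root_inv {v : Fin m} (hv : v ∈ RR.W) :
    v ∈ RR.rootBlock x v ∧ EqIn (rootGraph x) (RR.rootBlock x v) (RR.rootRef x) ∧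
      ConnIn (rootGraph x) (RR.rootBlock x v) (RR.rootRef x) := by
  have heqW : EqIn (rootGraph x) RR.W (RR.rootRef x) := fun u hu u' hu' hcu w hw =>
    BranchSum.equitableIn_refineIn RR.W (RR.rootCol x) hu hu' hcu hw
  exact ⟨BranchSum.self_mem_atom _ hv,
    fun u hu u' hu' hcu w hw => BranchSum.equitableIn_atom v heqW hu hu' hcu hw,
    fun S' hS' hne hSA => BranchSum.atom_connected (RR.rootRef x) hv hS' hne hSA⟩

/-- **A replay module wired to the root state of `v` reads that root state at stage `0`.** [folklore] -/
theorem stateReads_zero {F : ℕ} (RP : ReplayIter P (Fin m) N T J F) (v : Fin m)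
    (hmem : ∀ u, RP.memS 0 u = (RR.AI v).memW (Fin.last J) u)
    (hlt : ∀ a b, RP.ltS 0 a b = RR.RI.ltW (Fin.last T) a b) (heq : ∀ a b, RP.eqS 0 a b = RR.RI.eqW (Fin.last T) a b)
    (hN : RR.W.card ^ 2 ≤ N) (hT : RR.W.card ≤ T) (hJ : RR.W.card + 1 ≤ J) :
    RP.StateReads x 0 (RR.rootBlock x v) (RR.rootRef x) := by
  have hN1 : RR.W.card ≤ N := le_trans (Nat.le_self_pow two_ne_zero _) hN
  refine ⟨fun u => ?_, fun a ha b hb => ?_, fun a ha b hb => ?_⟩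
  · rw [hmem]; exact RR.sem_memW_last_iff x hN hT hJ v u
  · rw [hlt]; exact RR.sem_ltW_last_iff x hN1 hT (RR.rootBlock_subset x v ha) (RR.rootBlock_subset x v hb)
  · rw [heq]; exact RR.sem_eqW_last_iff x hN1 hT (RR.rootBlock_subset x v ha) (RR.rootBlock_subset x v hb)

/-- **From the matrix to every replayed state.** A replay module whose adjacency is the root module's, whose
pointer is `v ∈ W` and whose stage-`0` state wires are the root state wires of `v`, has at every stage `k ≤ F` state
wires reading the block and the order/kernel of the colouring of
`BranchSum.replay (rootGraph x) S hgt v k (rootBlock v, rootRef)`. [folklore] -/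
theorem stateReads_replay_root {F : ℕ} (RP : ReplayIter P (Fin m) N T J F) {v : Fin m} (hv : v ∈ RR.W)
    (hptr : RP.ptr = v) (hadj : ∀ a b, RP.adj a b = Sum.inr (RR.adjG a b))
    (hmem : ∀ u, RP.memS 0 u = (RR.AI v).memW (Fin.last J) u)
    (hlt : ∀ a b, RP.ltS 0 a b = RR.RI.ltW (Fin.last T) a b) (heq : ∀ a b, RP.eqS 0 a b = RR.RI.eqW (Fin.last T) a b)
    (hN : RR.W.card ^ 2 ≤ N) (hT : RR.W.card ≤ T) (hJ : RR.W.card + 1 ≤ J) (k : Fin (F + 1)) :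
    RP.StateReads x k (BranchSum.replay (rootGraph x) RP.S RP.hgt v k (RR.rootBlock x v, RR.rootRef x)).1
      (BranchSum.replay (rootGraph x) RP.S RP.hgt v k (RR.rootBlock x v, RR.rootRef x)).2 := by
  obtain ⟨hvA, hinv⟩ := RR.root_inv x hv
  have hcard : (RR.rootBlock x v).card ≤ RR.W.card := card_le_card (RR.rootBlock_subset x v)
  subst hptr
  exact ReplayIter.stateReads_replay' (G := rootGraph x) (fun a b => by rw [hadj, wval_inr]; exact RR.sem_adjG x a b)
    (RR.stateReads_zero x RP RP.ptr hmem hlt heq hN hT hJ) hvA (fun _ => hinv)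
    (le_trans (Nat.pow_le_pow_left hcard 2) hN) (hcard.trans hT) (by omega) k

end ReplayRoot

end Summit.PneNP.PneNP.Theorems
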